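import Mathlib.Analysis.Calculus.ContDiff.Basic
import Mathlib.Analysis.Calculus.ContDiff.FiniteDimension
import Mathlib.Analysis.InnerProductSpace.EuclideanDist
import Mathlib.Analysis.Convex.Topology
import HarnessLib

/-!
# Whitney's extension theorem, `C^∞` case, on closed convex sets with nonempty interior

H. Whitney, *Analytic extensions of differentiable functions defined in closed sets*, Trans.
Amer. Math. Soc. **36** (1934), 63–89. **Theorem I** (p. 65): *Let `A` be a closed subset of
`E = ℝⁿ`, and let `f(x) = f₀(x)` be of class `C^m` (`m` finite or infinite) in `A` in terms of
the `f_k(x)` (`σ_k ≤ m`). Then there is a function `F(x)` of class `C^m` in `E` in the ordinary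
sense such that (1) `F = f` in `A`, (2) `D_k F = f_k` in `A` (`σ_k ≤ m`), (3) `F` is analytic
in `E - A`.*  Here (§3, (3.1)–(3.2), p. 64) "`f` is of class `C^m` in `A` in terms of the `f_k`"
means that each `f_k` is the Taylor expansion of order `m - σ_k` of the others with a remainder
`|R_k(x'; x)| ≤ ε r_{xx'}^{m-σ_k}` for `x, x'` in `A` near any given point of `A`; class `C^∞`
means class `C^m` for every `m` (p. 65).  On a region, this is ordinary class `C^m` with `f_k`
the partial derivatives, and "the converse is true, by Taylor's Theorem" (§3, p. 65); the proof
of Theorem I for `m` infinite is §12 (Lemma 2), pp. 71–73.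

This file vendors, as a named fact (D-0014) — Mathlib has no extension theorem of Whitney type
(searched: `Whitney`, `extension` under `Mathlib.Analysis.Calculus`; the tree has Seeley's
reflection theorem for **half-spaces**, `Literature.Analysis.Calculus.Seeley.exists_contDiffOn_extension`,
`SeeleyExtension.lean`) — the consequence of Theorem I, case `m = ∞`, parts (1)–(2), for
**closed convex sets `K ⊆ ℝⁿ` with nonempty interior**: a real function of class `C^∞` on `K`
in Mathlib's *within* sense is the restriction to `K` of a `C^∞` function on `ℝⁿ`.  On such a
`K` (which has unique derivatives, `uniqueDiffOn_convex`) `ContDiffOn ℝ ∞ f K` says precisely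
that the iterated derivatives of `f` within `K` of all orders exist and are continuous on `K`,
i.e. up to the boundary (`ContDiffOn.continuousOn_iteratedFDerivWithin`,
`contDiffOn_of_continuousOn_differentiableOn`); by Taylor's formula on the segments of `K`
(which lie in `K`) and the uniform continuity of these derivatives on compact subsets of `K`,
the family of derivatives is of class `C^∞` in `K` in Whitney's sense (his remark in §3;
cf. Hörmander, *The Analysis of Linear Partial Differential Operators I*, discussion before
Thm. 2.3.6, p. 48), so Theorem I applies.

* `Literature.Analysis.Calculus.WhitneyExtensionConvex` — the named fact, for real functions on
  `EuclideanSpace ℝ (Fin n)` as in the source;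
* `Literature.Analysis.Calculus.WhitneyExtensionConvex.extension_euclidean`,
  `Literature.Analysis.Calculus.WhitneyExtensionConvex.extension` — proved corollaries: the
  same for maps into a finite-dimensional real normed space (coordinates in a basis) and out
  of a finite-dimensional real normed space (a linear change of coordinates, `toEuclidean`);
* `Literature.Analysis.Calculus.WhitneyExtensionConvex.exists_contDiffOn_extension` — proved
  local form: a map `C^∞` on `O ∩ C` (`O` open, `C` closed convex with nonempty interior)
  agrees near any point of `O ∩ C` with a map `C^∞` on an open neighbourhood — the shape in
  which the half-space theorem `Literature.Analysis.Calculus.Seeley.exists_contDiffOn_extension`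
  is consumed by the manifold files.

Intended consumer: the isotopy extension theorem for compact sources modelled on an
*arbitrary* model with corners (`Literature/Topology/FourManifolds/IsotopyExtensionCorners.lean`,
planned; fact seat `provefact-Literature.isSmoothlyIsotopic_iff_isAmbientIsotopic`): over `ℝ`
the range of a model with corners is closed and convex with nonempty interior
(`ModelWithCorners.isClosed_range`, `ModelWithCorners.convex_range`,
`ModelWithCorners.nonempty_interior`), and `C^∞` maps of manifolds with corners are `C^∞`
*within* the range in charts, so extending chart expressions off the range at corner points is
exactly this statement (at boundary points of the half-space model Seeley's theorem suffices).

What is NOT here: Whitney's differentiability in arbitrary closed sets and Theorem I in that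
generality (nor its finite-order case with bounds, Hörmander Thm. 2.3.6); analyticity of the
extension off `K` (Theorem I (3)); Theorems II–III of the paper; convex sets with empty
interior or infinite-dimensional spaces.

## References

* H. Whitney, *Analytic extensions of differentiable functions defined in closed sets*, Trans.
  Amer. Math. Soc. 36 (1934), 63–89: §3 (pp. 64–65), Theorem I (p. 65), §§11–12 (Lemma 2,
  pp. 69–73). [Whitney1934]
* L. Hörmander, *The Analysis of Linear Partial Differential Operators I*, 2nd ed., Springer
  (1990/2003), Thm. 2.3.6 and the preceding paragraph (p. 48). [HormanderALPDO1]
* R. T. Seeley, *Extension of `C^∞` functions defined in a half space*, Proc. Amer. Math. Soc.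
  15 (1964), 625–626. [Seeley1964]
-/

open Set Module Metric
open scoped ContDiff Topology

noncomputable section

namespace Literature.Analysis.Calculus

/-- **Whitney's extension theorem, `C^∞` case, on closed convex sets with nonempty interior.**
For a closed convex `K ⊆ ℝⁿ` with nonempty interior and a real function `f` of class `C^∞` on
`K` in the within sense (all iterated derivatives within `K` exist and are continuous up to the
boundary), there is a `C^∞` function `g` on `ℝⁿ` with `g = f` on `K`.  Whitney (1934),
Theorem I, `m` infinite, conclusions (1)–(2) (proof: §12, Lemma 2), applied to the family of
derivatives of `f` within `K`, which is of class `C^∞` in `K` in the sense of §3 by Taylor's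
formula on the segments of `K` (§3, p. 65, "the converse is true, by Taylor's Theorem").
[cite: Whitney1934, Thm. I (p. 65) with §3] -/
def WhitneyExtensionConvex : Prop :=
  ∀ (n : ℕ) (K : Set (EuclideanSpace ℝ (Fin n))), IsClosed K → Convex ℝ K →
    (interior K).Nonempty → ∀ f : EuclideanSpace ℝ (Fin n) → ℝ, ContDiffOn ℝ ∞ f K →
      ∃ g : EuclideanSpace ℝ (Fin n) → ℝ, ContDiff ℝ ∞ g ∧ EqOn g f K

namespace WhitneyExtensionConvex

/-- Vector-valued form on `ℝⁿ`: a map into a finite-dimensional real normed space which is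
`C^∞` on a closed convex set with nonempty interior extends to a `C^∞` map on `ℝⁿ` (apply the
theorem to the coordinates in a basis of the target). [cite: Whitney1934, Thm. I with §3] -/
theorem extension_euclidean (h : WhitneyExtensionConvex) {n : ℕ} {F : Type*}
    [NormedAddCommGroup F] [NormedSpace ℝ F] [FiniteDimensional ℝ F]
    {K : Set (EuclideanSpace ℝ (Fin n))} (hK : IsClosed K) (hKc : Convex ℝ K)
    (hKi : (interior K).Nonempty) {f : EuclideanSpace ℝ (Fin n) → F}
    (hf : ContDiffOn ℝ ∞ f K) :
    ∃ g : EuclideanSpace ℝ (Fin n) → F, ContDiff ℝ ∞ g ∧ EqOn g f K := by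
  set b := Module.finBasis ℝ F with hb
  set L : F ≃L[ℝ] (Fin (finrank ℝ F) → ℝ) := b.equivFun.toContinuousLinearEquiv with hL
  have hLf : ContDiffOn ℝ ∞ (fun x => L (f x)) K := L.contDiff.comp_contDiffOn hf
  have hcoord : ∀ i, ContDiffOn ℝ ∞ (fun x => L (f x) i) K := fun i => contDiffOn_pi.1 hLf i
  choose g hg hgf using fun i => h n K hK hKc hKi _ (hcoord i)
  refine ⟨fun x => ∑ i, g i x • b i, ContDiff.sum fun i _ => (hg i).smul contDiff_const,
    fun x hx => ?_⟩
  show ∑ i, g i x • b i = f x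
  calc ∑ i, g i x • b i = ∑ i, L (f x) i • b i :=
        Finset.sum_congr rfl fun i _ => by rw [hgf i hx]
    _ = f x := by
        rw [hL]
        simp only [LinearEquiv.coe_toContinuousLinearEquiv']
        exact b.sum_equivFun (f x)

/-- General finite-dimensional form: a map between finite-dimensional real normed spaces which
is `C^∞` (within) on a closed convex set `K` with nonempty interior is the restriction to `K` of
a `C^∞` map on the whole space (transport along the linear homeomorphism `toEuclidean`).
[cite: Whitney1934, Thm. I with §3] -/
theorem extension (h : WhitneyExtensionConvex) {E F : Type*} [NormedAddCommGroup E]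
    [NormedSpace ℝ E] [FiniteDimensional ℝ E] [NormedAddCommGroup F] [NormedSpace ℝ F]
    [FiniteDimensional ℝ F] {K : Set E} (hK : IsClosed K) (hKc : Convex ℝ K)
    (hKi : (interior K).Nonempty) {f : E → F} (hf : ContDiffOn ℝ ∞ f K) :
    ∃ g : E → F, ContDiff ℝ ∞ g ∧ EqOn g f K := by
  set L : E ≃L[ℝ] EuclideanSpace ℝ (Fin (finrank ℝ E)) := toEuclidean with hL
  set K' : Set (EuclideanSpace ℝ (Fin (finrank ℝ E))) := L.symm ⁻¹' K with hK'
  have hK'cl : IsClosed K' := hK.preimage L.symm.continuous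
  have hK'c : Convex ℝ K' := by
    intro x hx y hy a c ha hc hac
    show L.symm (a • x + c • y) ∈ K
    rw [map_add, map_smul, map_smul]
    exact hKc hx hy ha hc hac
  have hK'i : (interior K').Nonempty := by
    obtain ⟨x, hx⟩ := hKi
    refine ⟨L x, ?_⟩
    have h1 : L.symm.toHomeomorph ⁻¹' interior K = interior K' :=
      L.symm.toHomeomorph.preimage_interior K
    rw [← h1, mem_preimage, ContinuousLinearEquiv.coe_toHomeomorph, L.symm_apply_apply]
    exact hx
  have hf' : ContDiffOn ℝ ∞ (f ∘ L.symm) K' :=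
    hf.comp L.symm.contDiff.contDiffOn (mapsTo_preimage _ _)
  obtain ⟨g', hg', hg'f⟩ := h.extension_euclidean hK'cl hK'c hK'i hf'
  refine ⟨g' ∘ L, hg'.comp L.contDiff, fun x hx => ?_⟩
  have hxK' : L x ∈ K' := by
    rw [hK', mem_preimage, L.symm_apply_apply]
    exact hx
  show g' (L x) = f x
  rw [hg'f hxK', Function.comp_apply, L.symm_apply_apply]

/-- **Local form.**  Let `C` be a closed convex subset with nonempty interior of a
finite-dimensional real normed space, `O` open, and `f` of class `C^∞` on `O ∩ C` (within) with
values in a finite-dimensional space.  Then every `x₀ ∈ O ∩ C` has an open neighbourhood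
`O' ⊆ O` carrying a `C^∞` map `g` with `g = f` on `O' ∩ C` (apply the theorem to the closed
convex body `C ∩ closedBall x₀ r ⊆ O`, whose interior is nonempty because `x₀` lies in the
closure of the interior of `C`).  This is the shape of
`Literature.Analysis.Calculus.Seeley.exists_contDiffOn_extension` (half-spaces) for arbitrary
convex corners. [cite: Whitney1934, Thm. I with §3] -/
theorem exists_contDiffOn_extension (h : WhitneyExtensionConvex) {E F : Type*}
    [NormedAddCommGroup E] [NormedSpace ℝ E] [FiniteDimensional ℝ E] [NormedAddCommGroup F]
    [NormedSpace ℝ F] [FiniteDimensional ℝ F] {C : Set E} (hC : IsClosed C) (hCc : Convex ℝ C)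
    (hCi : (interior C).Nonempty) {O : Set E} (hO : IsOpen O) {x₀ : E} (hx₀O : x₀ ∈ O)
    (hx₀C : x₀ ∈ C) {f : E → F} (hf : ContDiffOn ℝ ∞ f (O ∩ C)) :
    ∃ O' : Set E, IsOpen O' ∧ x₀ ∈ O' ∧ O' ⊆ O ∧
      ∃ g : E → F, ContDiffOn ℝ ∞ g O' ∧ EqOn g f (O' ∩ C) := by
  obtain ⟨r, hr, hball⟩ : ∃ r > 0, closedBall x₀ r ⊆ O := by
    obtain ⟨r, hr, hrO⟩ := Metric.isOpen_iff.1 hO x₀ hx₀O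
    exact ⟨r / 2, half_pos hr, (closedBall_subset_ball (half_lt_self hr)).trans hrO⟩
  set K : Set E := C ∩ closedBall x₀ r with hK
  have hKcl : IsClosed K := hC.inter isClosed_closedBall
  have hKc : Convex ℝ K := hCc.inter (convex_closedBall x₀ r)
  have hKi : (interior K).Nonempty := by
    have hx₀ : x₀ ∈ closure (interior C) := by
      rw [hCc.closure_interior_eq_closure_of_nonempty_interior hCi]
      exact subset_closure hx₀C
    obtain ⟨y, hy⟩ := mem_closure_iff_nhds.1 hx₀ (ball x₀ r) (ball_mem_nhds x₀ hr)
    refine ⟨y, ?_⟩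
    rw [hK, interior_inter]
    exact ⟨hy.2, interior_mono ball_subset_closedBall (by rw [isOpen_ball.interior_eq]; exact hy.1)⟩
  obtain ⟨g, hg, hgf⟩ := h.extension hKcl hKc hKi (hf.mono fun x hx => ⟨hball hx.2, hx.1⟩)
  exact ⟨ball x₀ r, isOpen_ball, mem_ball_self hr, ball_subset_closedBall.trans hball, g,
    hg.contDiffOn, fun x hx => hgf ⟨hx.2, ball_subset_closedBall hx.1⟩⟩

end WhitneyExtensionConvex

end Literature.Analysis.Calculus
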